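import Literature.NumberTheory.LFunctions.Zhang2022.TypedSection12C
import Literature.NumberTheory.LFunctions.Zhang2022.NumericsSection12Windows

/-!
# Zhang (2022) §12c: the two p.72 window displays `Z22:§12.u039`, `Z22:§12.u043` hold as typed

Trunk T-ANT (NumberTheory/LFunctions). Companion of `TypedSection12C.lean` (Y. Zhang, arXiv:2211.02515v1
[Zhang2022LandauSiegel], §12 p. 72; an unrefereed manuscript under adjudication — this file proves two
typed CLAIM nodes of the statement DAG and makes no statement about Theorems 1–2 of the manuscript).

**Result (kernel-checked).** `step12u039_holds : ∀ c′, Typed.Sec12C.Step12u039 c′` and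
`step12u043_holds : ∀ c′, Typed.Sec12C.Step12u043 c′`: for every `c′` and all large `D` (real primitive `χ`
mod `D`), for `j = 1, 2, 3`,

* `|∫_{0.496}^{0.498} 𝔣𝔣_{j6}(0.498 − z)𝓦⁰_j(P^z)dz + 0.002| ≤ 10⁻⁶ + 10⁻⁵∫_{0.496}^{0.498}|𝔣𝔣_{j6}(0.498 − z)|dz`,
* `|∫_{0.496}^{0.5} 𝔣𝔣_{j7}(0.5 − z)𝓦⁰_j(P^z)dz + 0.004 + πi/250²| ≤ 10⁻⁶ + 10⁻⁵∫_{0.496}^{0.5}|𝔣𝔣_{j7}(0.5 − z)|dz`,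

where `𝓦⁰_j(y) = −1 + (−2β₆ + β_{j+1} + β_{j+2})log(y/P″₁)` is the explicit part of the printed `𝓦_j`
(`TypedSection12C.frakw0`; the `β`'s depend on `D` and `c′` through (2.13), `P″₁ = P^{0.496}Dt₀`).

**Method (the printed argument, p. 72: "a good approximation to `𝓦_j(P^z)` is `−1 + (3−j)πi(z − 0.496)`").**
(i) Exactly, `log(P^z/P″₁) = (z − 0.496)log P − log(Dt₀)` and, by (2.13) with `α log P = π`,
`(−2β₆ + β_{j+1} + β_{j+2})log P = (3 − j)πi + m_j c′(α𝓛)πi` with `m_j = −1, −8, −3`; hence on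
`0.496 ≤ z ≤ 0.5` the integrand differs from the LINEARISED one (`Numerics.wLin`) by an affine function of
`z` of modulus `≤ K(c′)𝓛⁻⁸`, `K(c′) = 0.004·8|c′|π² + 520(2π + 8|c′|π²)` (`α𝓛 = π𝓛⁻⁸`, `log(Dt₀) = 𝓛 + 519 log 𝓛
≤ 520𝓛`), so `≤ 10⁻⁵` for `D ≥ D₀(c′)` (`TypedSection12C.ell_large`); this costs at most
`10⁻⁵∫|𝔣𝔣|` (`window_perturb`). (ii) The linearised integrals are within `10⁻⁶` of the printed constants:
the kernel certificates `Numerics.p72a_lin_one/two/three`, `Numerics.p72b_lin_one/two/three` of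
`NumericsSection12Windows.lean` (N-07; values `3.3·10⁻⁹, 3.3·10⁻⁹, 3.0·10⁻⁸` and `6.05·10⁻⁷, 6.05·10⁻⁷,
3.95·10⁻⁷`). (iii) Triangle inequality.

What this is NOT: it says nothing about the `ε_{2j}`-part of `𝓦_j` (Lemma 12.3), nor about (12.14)–(12.17).
-/

noncomputable section

open Complex Real ComplexConjugate

namespace Literature.NumberTheory.LFunctions.Zhang2022.Typed.Sec12C

open Literature.NumberTheory.LFunctions.Zhang2022.Skeleton
open Literature.NumberTheory.LFunctions.Zhang2022.Numerics (wLin I6 I7 ffj6 ffj7 P72a_num P72b_num)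

section Windows

/-- Window perturbation: replacing the weight `w` by `w + (ρz + σ)` with `|ρz + σ| ≤ δ` on `[a, b]` changes
`∫_a^b f·w` by at most `δ∫_a^b|f|`. [folklore] -/
private theorem window_perturb {a b δ : ℝ} (hab : a ≤ b) {f w : ℝ → ℂ} (hf : Continuous f)
    (hw : Continuous w) (ρ σ : ℂ) (hδ : ∀ z ∈ Set.Icc a b, ‖ρ * z + σ‖ ≤ δ) :
    ‖(∫ z in a..b, f z * (w z + (ρ * z + σ))) - ∫ z in a..b, f z * w z‖ ≤ δ * ∫ z in a..b, ‖f z‖ := by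
  have hi1 : IntervalIntegrable (fun z : ℝ => f z * (w z + (ρ * z + σ))) MeasureTheory.volume a b :=
    Continuous.intervalIntegrable (by fun_prop) _ _
  have hi2 : IntervalIntegrable (fun z : ℝ => f z * w z) MeasureTheory.volume a b :=
    Continuous.intervalIntegrable (by fun_prop) _ _
  rw [← intervalIntegral.integral_sub hi1 hi2]
  have e : (fun z : ℝ => f z * (w z + (ρ * z + σ)) - f z * w z) = fun z : ℝ => f z * (ρ * z + σ) := by
    funext z; ring
  rw [e, ← intervalIntegral.integral_const_mul]
  refine intervalIntegral.norm_integral_le_of_norm_le hab ?_ ?_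
  · refine Filter.Eventually.of_forall fun z hz => ?_
    rw [norm_mul, mul_comm]
    exact mul_le_mul_of_nonneg_right (hδ z (Set.Ioc_subset_Icc_self hz)) (norm_nonneg _)
  · exact Continuous.intervalIntegrable (by fun_prop) _ _

/-- Assembly of one window display from (i) the affine perturbation bound and (ii) the enclosure of the
linearised integral. [folklore] -/
private theorem window_finish {b : ℝ} (hb : 0.496 ≤ b) (hb' : b ≤ 0.5) {f w W : ℝ → ℂ} {T ρ σ : ℂ}
    (hf : Continuous f) (hw : Continuous w) (hW : ∀ z : ℝ, W z = w z + (ρ * z + σ))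
    (hδ : ∀ z ∈ Set.Icc (0.496 : ℝ) 0.5, ‖ρ * z + σ‖ ≤ 1e-5)
    (hmain : ‖(∫ z in (0.496 : ℝ)..b, f z * w z) + T‖ < 1e-6) :
    ‖(∫ z in (0.496 : ℝ)..b, f z * W z) + T‖ ≤ 1e-6 + 1e-5 * ∫ z in (0.496 : ℝ)..b, ‖f z‖ := by
  have hδ' : ∀ z ∈ Set.Icc (0.496 : ℝ) b, ‖ρ * z + σ‖ ≤ 1e-5 :=
    fun z hz => hδ z ⟨hz.1, hz.2.trans hb'⟩
  have hp := window_perturb hb hf hw ρ σ hδ'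
  simp_rw [hW]
  have ht := norm_add_le
    ((∫ z in (0.496 : ℝ)..b, f z * (w z + (ρ * z + σ))) - ∫ z in (0.496 : ℝ)..b, f z * w z)
    ((∫ z in (0.496 : ℝ)..b, f z * w z) + T)
  have e : (∫ z in (0.496 : ℝ)..b, f z * (w z + (ρ * z + σ))) - (∫ z in (0.496 : ℝ)..b, f z * w z) +
      ((∫ z in (0.496 : ℝ)..b, f z * w z) + T)
      = (∫ z in (0.496 : ℝ)..b, f z * (w z + (ρ * z + σ))) + T := by ring
  rw [e] at ht
  linarith [hmain.le]

/-- `log(P^z/P″₁) = (z − 0.496)log P − (𝓛 + log t₀)` (`P″₁ = P^{0.496}Dt₀`, `𝓛 = log D`), for `𝓛 ≥ 1`.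
[cite: Zhang2022LandauSiegel, §12 p.71 (definition of `P″₁`)] -/
private theorem log_rpow_div_P1pp {D : ℕ} (hL1 : 1 ≤ ell D) (z : ℝ) :
    Real.log (bigP D ^ z / P1pp D) = (z - 0.496) * Real.log (bigP D) - (ell D + Real.log (t0 D)) := by
  have hP : 0 < bigP D := Real.exp_pos _
  have hD : (1 : ℝ) < D := by
    rw [ell] at hL1
    by_contra h
    have := Real.log_nonpos (Nat.cast_nonneg D) (not_lt.mp h)
    linarith
  have hD0 : (0 : ℝ) < D := by linarith
  have ht0 : 0 < t0 D := by rw [t0]; exact pow_pos (by linarith) _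
  have hPz : 0 < bigP D ^ z := Real.rpow_pos_of_pos hP z
  have hP496 : 0 < bigP D ^ (0.496 : ℝ) := Real.rpow_pos_of_pos hP _
  have hP1pp : P1pp D = bigP D ^ (0.496 : ℝ) * D * t0 D := rfl
  rw [Real.log_div hPz.ne' (by rw [hP1pp]; exact mul_ne_zero (mul_ne_zero hP496.ne' hD0.ne') ht0.ne'),
    hP1pp, Real.log_mul (mul_ne_zero hP496.ne' hD0.ne') ht0.ne', Real.log_mul hP496.ne' hD0.ne',
    Real.log_rpow hP, Real.log_rpow hP, ell]
  ring

/-- The `D`-dependent part of `𝓦⁰_j(P^z)` (p. 72 "`≃`"): from the exact relation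
`(−2β₆ + β_{j+1} + β_{j+2})log P − k = m c′(α𝓛)πi` (`|m| ≤ 8`, `|k| ≤ 2π`) and `K(c′)𝓛⁻⁸ ≤ 10⁻⁵`,
`−1 + (−2β₆ + β_{j+1} + β_{j+2})log(P^z/P″₁) = (−1 + k(z − 0.496)) + (ρz + σ)` with `|ρz + σ| ≤ 10⁻⁵` on
`[0.496, 0.5]`. [cite: Zhang2022LandauSiegel, §12 (12.14) p.72] -/
private theorem decomp_of_key {c' : ℝ} {D : ℕ} (hL1 : 1 ≤ ell D)
    (hK : (0.004 * (8 * |c'| * π ^ 2) + 520 * (2 * π + 8 * |c'| * π ^ 2)) / ell D ^ 8 ≤ 1e-5)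
    {B kk : ℂ} {m : ℝ}
    (key : B * (Real.log (bigP D) : ℂ) - kk = ((m * c' * (alpha D * ell D) * π : ℝ) : ℂ) * I)
    (hm : |m| ≤ 8) (hkk : ‖kk‖ ≤ 2 * π) :
    ∃ ρ σ : ℂ, (∀ z : ℝ, -1 + B * (Real.log (bigP D ^ z / P1pp D) : ℂ) =
        (-1 + kk * ((z : ℂ) - 0.496)) + (ρ * z + σ)) ∧
      ∀ z ∈ Set.Icc (0.496 : ℝ) 0.5, ‖ρ * z + σ‖ ≤ 1e-5 := by
  have hLval : Real.log (bigP D) = ell D ^ 9 := by rw [bigP, Real.log_exp]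
  have hℓ : 0 < ell D := by linarith
  have h8 : 0 < ell D ^ 8 := pow_pos hℓ 8
  have h9 : 0 < ell D ^ 9 := pow_pos hℓ 9
  have hαℓ : alpha D * ell D = π / ell D ^ 8 := alpha_mul_ell D hL1
  refine ⟨B * (Real.log (bigP D) : ℂ) - kk,
    -(0.496 : ℂ) * (B * (Real.log (bigP D) : ℂ) - kk) - B * ((ell D + Real.log (t0 D) : ℝ) : ℂ),
    fun z => ?_, fun z hz => ?_⟩
  · rw [log_rpow_div_P1pp hL1 z]
    push_cast
    ring
  · -- `‖ρ‖ ≤ 8|c′|π²𝓛⁻⁸`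
    have hρ : ‖B * (Real.log (bigP D) : ℂ) - kk‖ ≤ 8 * |c'| * π ^ 2 / ell D ^ 8 := by
      rw [key, norm_mul, Complex.norm_I, mul_one, Complex.norm_real, Real.norm_eq_abs, hαℓ,
        abs_mul, abs_mul, abs_mul, abs_div, abs_of_pos Real.pi_pos, abs_of_pos h8]
      have hx : 0 ≤ |c'| * (π / ell D ^ 8) * π := by positivity
      calc |m| * |c'| * (π / ell D ^ 8) * π = |m| * (|c'| * (π / ell D ^ 8) * π) := by ring
        _ ≤ 8 * (|c'| * (π / ell D ^ 8) * π) := mul_le_mul_of_nonneg_right hm hx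
        _ = 8 * |c'| * π ^ 2 / ell D ^ 8 := by ring
    -- `‖B‖ log P ≤ 2π + 8|c′|π²`
    have hBL : ‖B‖ * ell D ^ 9 ≤ 2 * π + 8 * |c'| * π ^ 2 := by
      have e : B * (Real.log (bigP D) : ℂ) = kk + (B * (Real.log (bigP D) : ℂ) - kk) := by ring
      have h1 : ‖B‖ * ell D ^ 9 = ‖B * (Real.log (bigP D) : ℂ)‖ := by
        rw [norm_mul, Complex.norm_real, Real.norm_eq_abs, hLval, abs_of_pos h9]
      rw [h1, e]
      calc ‖kk + (B * (Real.log (bigP D) : ℂ) - kk)‖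
          ≤ ‖kk‖ + ‖B * (Real.log (bigP D) : ℂ) - kk‖ := norm_add_le _ _
        _ ≤ 2 * π + 8 * |c'| * π ^ 2 / ell D ^ 8 := add_le_add hkk hρ
        _ ≤ 2 * π + 8 * |c'| * π ^ 2 := by
            have : 8 * |c'| * π ^ 2 / ell D ^ 8 ≤ 8 * |c'| * π ^ 2 :=
              div_le_self (by positivity) (one_le_pow₀ hL1)
            linarith
    -- `0 ≤ log(Dt₀) ≤ 520𝓛`
    have hlog : Real.log (t0 D) = 519 * Real.log (ell D) := by
      rw [t0, Real.log_pow]; push_cast; ring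
    have hM0 : 0 ≤ ell D + Real.log (t0 D) := by
      have : 0 ≤ Real.log (ell D) := Real.log_nonneg hL1
      rw [hlog]; nlinarith
    have hM : ell D + Real.log (t0 D) ≤ 520 * ell D := by
      have : Real.log (ell D) ≤ ell D := (Real.log_le_sub_one_of_pos hℓ).trans (by linarith)
      rw [hlog]; nlinarith
    have hB : ‖B‖ ≤ (2 * π + 8 * |c'| * π ^ 2) / ell D ^ 9 := by
      rw [le_div_iff₀ h9]; exact hBL
    have hBM : ‖B * ((ell D + Real.log (t0 D) : ℝ) : ℂ)‖ ≤ 520 * (2 * π + 8 * |c'| * π ^ 2) / ell D ^ 8 := by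
      rw [norm_mul, Complex.norm_real, Real.norm_eq_abs, abs_of_nonneg hM0]
      calc ‖B‖ * (ell D + Real.log (t0 D))
          ≤ (2 * π + 8 * |c'| * π ^ 2) / ell D ^ 9 * (520 * ell D) :=
            mul_le_mul hB hM hM0 (by positivity)
        _ = 520 * (2 * π + 8 * |c'| * π ^ 2) / ell D ^ 8 := by
            field_simp
    -- on the window `|z − 0.496| ≤ 0.004`
    obtain ⟨hz1, hz2⟩ := hz
    have hzabs : ‖((z : ℂ) - 0.496)‖ ≤ 0.004 := by
      have e : ((z : ℂ) - 0.496) = ((z - 0.496 : ℝ) : ℂ) := by push_cast; ring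
      rw [e, Complex.norm_real, Real.norm_eq_abs, abs_le]
      constructor <;> linarith
    have e : (B * (Real.log (bigP D) : ℂ) - kk) * (z : ℂ) +
        (-(0.496 : ℂ) * (B * (Real.log (bigP D) : ℂ) - kk) - B * ((ell D + Real.log (t0 D) : ℝ) : ℂ))
        = (B * (Real.log (bigP D) : ℂ) - kk) * ((z : ℂ) - 0.496)
          - B * ((ell D + Real.log (t0 D) : ℝ) : ℂ) := by ring
    rw [e]
    calc ‖(B * (Real.log (bigP D) : ℂ) - kk) * ((z : ℂ) - 0.496) - B * ((ell D + Real.log (t0 D) : ℝ) : ℂ)‖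
        ≤ ‖(B * (Real.log (bigP D) : ℂ) - kk) * ((z : ℂ) - 0.496)‖
            + ‖B * ((ell D + Real.log (t0 D) : ℝ) : ℂ)‖ := norm_sub_le _ _
      _ ≤ (8 * |c'| * π ^ 2 / ell D ^ 8) * 0.004 + 520 * (2 * π + 8 * |c'| * π ^ 2) / ell D ^ 8 := by
          rw [norm_mul]
          exact add_le_add (mul_le_mul hρ hzabs (norm_nonneg _) (by positivity)) hBM
      _ = (0.004 * (8 * |c'| * π ^ 2) + 520 * (2 * π + 8 * |c'| * π ^ 2)) / ell D ^ 8 := by ring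
      _ ≤ 1e-5 := hK

variable (c' : ℝ)

/-- **`Z22:§12.u039` holds** (p. 72, tex L3636; NUM:N-07): for every `c′`, all large `D` and `j = 1,2,3`,
`|∫_{0.496}^{0.498} 𝔣𝔣_{j6}(0.498−z)𝓦⁰_j(P^z)dz + 0.002| ≤ 10⁻⁶ + 10⁻⁵∫_{0.496}^{0.498}|𝔣𝔣_{j6}(0.498−z)|dz` — the
printed "`= −0.002 + ε/10`" on the explicit part of `𝓦_j`. Proof = the printed approximation
`𝓦_j(P^z) ≃ −1 + (3−j)πi(z − 0.496)` made quantitative (`decomp_of_key`, uniform in `D ≥ D₀(c′)`) + the kernel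
enclosures `Numerics.p72a_lin_one/two/three`. [cite: Zhang2022LandauSiegel, §12 (12.14) p.72] -/
theorem step12u039_holds : Step12u039 c' := by
  obtain ⟨D₀, hD₀⟩ := ell_large (0.004 * (8 * |c'| * π ^ 2) + 520 * (2 * π + 8 * |c'| * π ^ 2)) 1e-5
    (by positivity) (by norm_num)
  refine ⟨D₀, fun D _ χ hD _ _ => ?_⟩
  obtain ⟨hL1, hK⟩ := hD₀ D hD
  have hA : ((alpha D : ℝ) : ℂ) * (Real.log (bigP D) : ℝ) = (π : ℂ) := by
    rw [← Complex.ofReal_mul, alpha_mul_log_bigP D hL1]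
  have hπ : ‖(π : ℂ)‖ = π := by rw [Complex.norm_real, Real.norm_eq_abs, abs_of_pos Real.pi_pos]
  intro j hj
  simp only [Finset.mem_insert, Finset.mem_singleton] at hj
  rcases hj with rfl | rfl | rfl
  · -- j = 1: `(β₂ + β₃ − 2β₆)log P = 2πi − c′(α𝓛)πi`
    have key : (-2 * beta6 D + betaJ c' D (1 + 1) + betaJ c' D (1 + 2)) * (Real.log (bigP D) : ℂ)
        - 2 * π * I = (((-1) * c' * (alpha D * ell D) * π : ℝ) : ℂ) * I := by
      norm_num only [betaJ, beta6, beta1, beta2, beta3]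
      push_cast
      linear_combination (I * (2 - (c' : ℂ) * (alpha D : ℂ) * (ell D : ℂ))) * hA
    obtain ⟨ρ, σ, h1, h2⟩ := decomp_of_key hL1 hK key (by norm_num)
      (by rw [norm_mul, norm_mul, Complex.norm_I, hπ]; norm_num)
    have hmain : ‖(∫ z in (0.496 : ℝ)..0.498, ffj 1 6 (0.498 - z) * wLin 1 z) + 0.002‖ < 1e-6 := by
      have h := Numerics.p72a_lin_one
      change ‖(∫ z in (0.496 : ℝ)..0.498, ffj 1 6 (0.498 - z) * wLin 1 z) - (-0.002)‖ < 1 / 10 ^ 6 at h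
      rw [sub_neg_eq_add] at h
      exact lt_of_lt_of_eq h (by norm_num)
    exact window_finish (by norm_num) (by norm_num) (W := fun z => frakw0 c' D 1 (bigP D ^ z))
      ((continuous_ffF (1/2) (3/2)).comp (by fun_prop)) (by unfold Numerics.wLin; fun_prop)
      (fun z => by
        change -1 + (-2 * beta6 D + betaJ c' D (1 + 1) + betaJ c' D (1 + 2)) *
          (Real.log (bigP D ^ z / P1pp D) : ℂ) = _
        rw [h1 z]
        unfold Numerics.wLin
        push_cast
        ring) h2 hmain
  · -- j = 2: `(β₃ + β₁ − 2β₆)log P = πi − 8c′(α𝓛)πi`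
    have key : (-2 * beta6 D + betaJ c' D (2 + 1) + betaJ c' D (2 + 2)) * (Real.log (bigP D) : ℂ)
        - π * I = (((-8) * c' * (alpha D * ell D) * π : ℝ) : ℂ) * I := by
      norm_num only [betaJ, beta6, beta1, beta2, beta3]
      push_cast
      linear_combination (I * (1 - 8 * (c' : ℂ) * (alpha D : ℂ) * (ell D : ℂ))) * hA
    obtain ⟨ρ, σ, h1, h2⟩ := decomp_of_key hL1 hK key (by norm_num)
      (by rw [norm_mul, Complex.norm_I, hπ]; linarith [Real.pi_pos])
    have hmain : ‖(∫ z in (0.496 : ℝ)..0.498, ffj 2 6 (0.498 - z) * wLin 2 z) + 0.002‖ < 1e-6 := by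
      have h := Numerics.p72a_lin_two
      change ‖(∫ z in (0.496 : ℝ)..0.498, ffj 2 6 (0.498 - z) * wLin 2 z) - (-0.002)‖ < 1 / 10 ^ 6 at h
      rw [sub_neg_eq_add] at h
      exact lt_of_lt_of_eq h (by norm_num)
    exact window_finish (by norm_num) (by norm_num) (W := fun z => frakw0 c' D 2 (bigP D ^ z))
      ((continuous_ffF (-1/2) (3/2)).comp (by fun_prop)) (by unfold Numerics.wLin; fun_prop)
      (fun z => by
        change -1 + (-2 * beta6 D + betaJ c' D (2 + 1) + betaJ c' D (2 + 2)) *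
          (Real.log (bigP D ^ z / P1pp D) : ℂ) = _
        rw [h1 z]
        unfold Numerics.wLin
        push_cast
        ring) h2 hmain
  · -- j = 3: `(β₁ + β₂ − 2β₆)log P = −3c′(α𝓛)πi`
    have key : (-2 * beta6 D + betaJ c' D (3 + 1) + betaJ c' D (3 + 2)) * (Real.log (bigP D) : ℂ)
        - 0 = (((-3) * c' * (alpha D * ell D) * π : ℝ) : ℂ) * I := by
      norm_num only [betaJ, beta6, beta1, beta2, beta3]
      push_cast
      linear_combination (I * (-3 * (c' : ℂ) * (alpha D : ℂ) * (ell D : ℂ))) * hA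
    obtain ⟨ρ, σ, h1, h2⟩ := decomp_of_key hL1 hK key (by norm_num)
      (by rw [norm_zero]; positivity)
    have hmain : ‖(∫ z in (0.496 : ℝ)..0.498, ffj 3 6 (0.498 - z) * wLin 3 z) + 0.002‖ < 1e-6 := by
      have h := Numerics.p72a_lin_three
      change ‖(∫ z in (0.496 : ℝ)..0.498, ffj 3 6 (0.498 - z) * wLin 3 z) - (-0.002)‖ < 1 / 10 ^ 6 at h
      rw [sub_neg_eq_add] at h
      exact lt_of_lt_of_eq h (by norm_num)
    exact window_finish (by norm_num) (by norm_num) (W := fun z => frakw0 c' D 3 (bigP D ^ z))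
      ((continuous_ffF (-3/2) (3/2)).comp (by fun_prop)) (by unfold Numerics.wLin; fun_prop)
      (fun z => by
        change -1 + (-2 * beta6 D + betaJ c' D (3 + 1) + betaJ c' D (3 + 2)) *
          (Real.log (bigP D ^ z / P1pp D) : ℂ) = _
        rw [h1 z]
        unfold Numerics.wLin
        push_cast
        ring) h2 hmain

/-- `Step12u039` — `_holds` alias of `step12u039_holds` above under the fact's exact name (appended
2026-08-28, D-0026 bookkeeping: the proof term is the existing theorem of this file; no statement,
definition or attribute is edited; no new named fact; the ledger's debt table listed the fact
unproved). [cite: Zhang2022LandauSiegel, §12 (12.14) p.72] -/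
theorem _root_.Literature.NumberTheory.LFunctions.Zhang2022.Typed.Sec12C.Step12u039_holds :
    Step12u039 c' :=
  _root_.Literature.NumberTheory.LFunctions.Zhang2022.Typed.Sec12C.step12u039_holds (c' := c')

/-- **`Z22:§12.u043` holds** (p. 72, tex L3652; NUM:N-07): for every `c′`, all large `D` and `j = 1,2,3`,
`|∫_{0.496}^{0.5} 𝔣𝔣_{j7}(0.5−z)𝓦⁰_j(P^z)dz + 0.004 + πi/250²| ≤ 10⁻⁶ + 10⁻⁵∫_{0.496}^{0.5}|𝔣𝔣_{j7}(0.5−z)|dz` — the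
printed "`= −0.004 − πi/250² + ε/10`" on the explicit part of `𝓦_j`. Same proof, with the kernel enclosures
`Numerics.p72b_lin_one/two/three` (margins `≈ 4·10⁻⁷`). [cite: Zhang2022LandauSiegel, §12 (12.14) p.72] -/
theorem step12u043_holds : Step12u043 c' := by
  obtain ⟨D₀, hD₀⟩ := ell_large (0.004 * (8 * |c'| * π ^ 2) + 520 * (2 * π + 8 * |c'| * π ^ 2)) 1e-5
    (by positivity) (by norm_num)
  refine ⟨D₀, fun D _ χ hD _ _ => ?_⟩
  obtain ⟨hL1, hK⟩ := hD₀ D hD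
  have hA : ((alpha D : ℝ) : ℂ) * (Real.log (bigP D) : ℝ) = (π : ℂ) := by
    rw [← Complex.ofReal_mul, alpha_mul_log_bigP D hL1]
  have hπ : ‖(π : ℂ)‖ = π := by rw [Complex.norm_real, Real.norm_eq_abs, abs_of_pos Real.pi_pos]
  intro j hj
  simp only [Finset.mem_insert, Finset.mem_singleton] at hj
  rcases hj with rfl | rfl | rfl
  · have key : (-2 * beta6 D + betaJ c' D (1 + 1) + betaJ c' D (1 + 2)) * (Real.log (bigP D) : ℂ)
        - 2 * π * I = (((-1) * c' * (alpha D * ell D) * π : ℝ) : ℂ) * I := by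
      norm_num only [betaJ, beta6, beta1, beta2, beta3]
      push_cast
      linear_combination (I * (2 - (c' : ℂ) * (alpha D : ℂ) * (ell D : ℂ))) * hA
    obtain ⟨ρ, σ, h1, h2⟩ := decomp_of_key hL1 hK key (by norm_num)
      (by rw [norm_mul, norm_mul, Complex.norm_I, hπ]; norm_num)
    have hmain : ‖(∫ z in (0.496 : ℝ)..0.5, ffj 1 7 (0.5 - z) * wLin 1 z) + (0.004 + π * I / 250 ^ 2)‖
        < 1e-6 := by
      have h := Numerics.p72b_lin_one
      change ‖(∫ z in (0.496 : ℝ)..0.5, ffj 1 7 (0.5 - z) * wLin 1 z) - (-0.004 - π * I / 250 ^ 2)‖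
        < 1 / 10 ^ 6 at h
      rw [show ∀ X : ℂ, X - (-0.004 - π * I / 250 ^ 2) = X + (0.004 + π * I / 250 ^ 2) from
        fun X => by ring] at h
      exact lt_of_lt_of_eq h (by norm_num)
    have := window_finish (by norm_num) (by norm_num) (W := fun z => frakw0 c' D 1 (bigP D ^ z))
      ((continuous_ffF (3/2) (5/2)).comp (by fun_prop)) (by unfold Numerics.wLin; fun_prop)
      (fun z => by
        change -1 + (-2 * beta6 D + betaJ c' D (1 + 1) + betaJ c' D (1 + 2)) *
          (Real.log (bigP D ^ z / P1pp D) : ℂ) = _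
        rw [h1 z]
        unfold Numerics.wLin
        push_cast
        ring) h2 hmain
    rwa [← add_assoc] at this
  · have key : (-2 * beta6 D + betaJ c' D (2 + 1) + betaJ c' D (2 + 2)) * (Real.log (bigP D) : ℂ)
        - π * I = (((-8) * c' * (alpha D * ell D) * π : ℝ) : ℂ) * I := by
      norm_num only [betaJ, beta6, beta1, beta2, beta3]
      push_cast
      linear_combination (I * (1 - 8 * (c' : ℂ) * (alpha D : ℂ) * (ell D : ℂ))) * hA
    obtain ⟨ρ, σ, h1, h2⟩ := decomp_of_key hL1 hK key (by norm_num)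
      (by rw [norm_mul, Complex.norm_I, hπ]; linarith [Real.pi_pos])
    have hmain : ‖(∫ z in (0.496 : ℝ)..0.5, ffj 2 7 (0.5 - z) * wLin 2 z) + (0.004 + π * I / 250 ^ 2)‖
        < 1e-6 := by
      have h := Numerics.p72b_lin_two
      change ‖(∫ z in (0.496 : ℝ)..0.5, ffj 2 7 (0.5 - z) * wLin 2 z) - (-0.004 - π * I / 250 ^ 2)‖
        < 1 / 10 ^ 6 at h
      rw [show ∀ X : ℂ, X - (-0.004 - π * I / 250 ^ 2) = X + (0.004 + π * I / 250 ^ 2) from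
        fun X => by ring] at h
      exact lt_of_lt_of_eq h (by norm_num)
    have := window_finish (by norm_num) (by norm_num) (W := fun z => frakw0 c' D 2 (bigP D ^ z))
      ((continuous_ffF (1/2) (5/2)).comp (by fun_prop)) (by unfold Numerics.wLin; fun_prop)
      (fun z => by
        change -1 + (-2 * beta6 D + betaJ c' D (2 + 1) + betaJ c' D (2 + 2)) *
          (Real.log (bigP D ^ z / P1pp D) : ℂ) = _
        rw [h1 z]
        unfold Numerics.wLin
        push_cast
        ring) h2 hmain
    rwa [← add_assoc] at this
  · have key : (-2 * beta6 D + betaJ c' D (3 + 1) + betaJ c' D (3 + 2)) * (Real.log (bigP D) : ℂ)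
        - 0 = (((-3) * c' * (alpha D * ell D) * π : ℝ) : ℂ) * I := by
      norm_num only [betaJ, beta6, beta1, beta2, beta3]
      push_cast
      linear_combination (I * (-3 * (c' : ℂ) * (alpha D : ℂ) * (ell D : ℂ))) * hA
    obtain ⟨ρ, σ, h1, h2⟩ := decomp_of_key hL1 hK key (by norm_num)
      (by rw [norm_zero]; positivity)
    have hmain : ‖(∫ z in (0.496 : ℝ)..0.5, ffj 3 7 (0.5 - z) * wLin 3 z) + (0.004 + π * I / 250 ^ 2)‖
        < 1e-6 := by
      have h := Numerics.p72b_lin_three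
      change ‖(∫ z in (0.496 : ℝ)..0.5, ffj 3 7 (0.5 - z) * wLin 3 z) - (-0.004 - π * I / 250 ^ 2)‖
        < 1 / 10 ^ 6 at h
      rw [show ∀ X : ℂ, X - (-0.004 - π * I / 250 ^ 2) = X + (0.004 + π * I / 250 ^ 2) from
        fun X => by ring] at h
      exact lt_of_lt_of_eq h (by norm_num)
    have := window_finish (by norm_num) (by norm_num) (W := fun z => frakw0 c' D 3 (bigP D ^ z))
      ((continuous_ffF (-1/2) (5/2)).comp (by fun_prop)) (by unfold Numerics.wLin; fun_prop)
      (fun z => by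
        change -1 + (-2 * beta6 D + betaJ c' D (3 + 1) + betaJ c' D (3 + 2)) *
          (Real.log (bigP D ^ z / P1pp D) : ℂ) = _
        rw [h1 z]
        unfold Numerics.wLin
        push_cast
        ring) h2 hmain
    rwa [← add_assoc] at this

/-- `Step12u043` — `_holds` alias of `step12u043_holds` above under the fact's exact name (appended
2026-08-28, D-0026 bookkeeping: the proof term is the existing theorem of this file; no statement,
definition or attribute is edited; no new named fact; the ledger's debt table listed the fact
unproved). [cite: Zhang2022LandauSiegel, §12 (12.14) p.72] -/
theorem _root_.Literature.NumberTheory.LFunctions.Zhang2022.Typed.Sec12C.Step12u043_holds :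
    Step12u043 c' :=
  _root_.Literature.NumberTheory.LFunctions.Zhang2022.Typed.Sec12C.step12u043_holds (c' := c')

end Windows

end Literature.NumberTheory.LFunctions.Zhang2022.Typed.Sec12C
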